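import Summits.CriticalPhenomena.CardyFormulaZ2.Theorems.CardyBoundaryCoulombGasRectilinearCardyStubEventIdentityPart2
import Summits.CriticalPhenomena.CardyFormulaZ2.Theorems.CardyBoundaryCoulombGasBoundaryDefectGaussianRStubRealisabilityPart35

/-!
# Stub `stub_eventIdentity` of line `excursion-kernel-covariance` (crux `RectilinearCardy`,
# stmt-CriticalPhenomena-5660) — Part 4: the collar faces of a free stretch form a closed-edge face
# chain (layer L7 of the design `Lines/excursion-kernel-covariance-eventIdentity-design.md`)

For a general collar leg model `M` on `V`, live-open edges `ω ⊆ M.E`, `β = M.cfgOf ω`, and the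
counter-clockwise boundary walk `dsucc V` of exterior darts:

* `ei_gapFace_site` / `ei_gapFace_dsucc_site` — the gap face after the exterior dart `(v, K)` is the
  face `cFace (toSite v, K) = faceAt (toSite v) K` of the corner calculus, and the gap face of any dart
  whose successor is `(v, K)` is `faceAt (toSite v) (K + 3)`: the two faces on the two sides of the
  exterior edge `s(toSite v, toSite v + cornerUnit K)` at `v` (`se_gapFace_eq_cFace`,
  `tc_gapFace_of_dsucc` of the engine line);
* `ei_exteriorEdge_not_mem_cfgOf` — the exterior edge of a dart at a vertex that is NOT an arc vertex
  is absent from the completed configuration (it is neither live nor a spoke);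
* `ei_faceChain_of_free` — hence along a stretch of the walk `e i = (dsucc V)^[i] d₀`, `a ≤ i ≤ b`,
  all of whose darts after the first sit at non-arc vertices (a FREE stretch), the gap faces of `e a`
  and `e b` are joined by a closed-edge face chain of `β` (the inline `Relation.ReflTransGen` relation
  of Part 3): consecutive gap faces are the two faces of the closed exterior edge of the later dart.

All [folklore]; no new objects.
-/

namespace Summit.CriticalPhenomena.CardyFormulaZ2.Cruxes.RectilinearCardy.ExcursionKernelCovariance

open Finset Literature.Probability.LatticeModels Literature.Probability.LatticeModels.CollarLegModel
open Summit.CriticalPhenomena.CardyFormulaZ2.Cruxes.BoundaryDefectGaussianR.RainbowMonomialsInExcursionKernels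

section FreeStretch

variable {M : CollarLegModel} {ω : Finset ((ℤ × ℤ) × Bool)}

/-- `ofSite` is injective on `Site 2`. [folklore] -/
theorem ei_ofSite_injective : Function.Injective (ofSite : Site 2 → ℤ × ℤ) := by
  intro a b h
  have ha := ei_corner_eq (a, (0 : Fin 4))
  have hb := ei_corner_eq (b, (0 : Fin 4))
  simp only at ha hb
  rw [Prod.mk.injEq] at ha hb
  rw [ha.1, hb.1, h]

/-- **The gap face after an exterior dart in the corner calculus**: `gapFace (v, K)` is (the lattice
face of) `faceAt (toSite v) K`, the face of the corner `(toSite v, K)`. [folklore] -/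
theorem ei_gapFace_site (v : ℤ × ℤ) (K : Fin 4) : gapFace (v, K) = ofSite (faceAt (toSite v) K) :=
  (se_gapFace_eq_cFace v K).1

/-- **The gap face before**: if the successor of the exterior dart `d` is `(v, K)`, the gap face of
`d` is `faceAt (toSite v) (K + 3)`, the other face at `v` bordering the exterior edge in direction `K`.
[folklore] -/
theorem ei_gapFace_dsucc_site {V : Finset (ℤ × ℤ)} {d : Dart} {v : ℤ × ℤ} {K : Fin 4}
    (h : dsucc V d = (v, K)) : gapFace d = ofSite (faceAt (toSite v) (K + 3)) := by
  rw [tc_gapFace_of_dsucc h]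
  exact (se_gapFace_eq_cFace v K).2.2.1

/-- **The exterior edge at a non-arc vertex is absent from the completed configuration.** For
`ω ⊆ M.E` and an exterior dart `(v, K)` of `M.V` (`v ∈ V`, `v + dir K ∉ V`) whose vertex is not an arc
vertex, the lattice edge `s(toSite v, toSite v + cornerUnit K)` (the target of the corner
`(toSite v, K + 3)`) is not in `M.cfgOf ω`: it is not live (its tip is outside `V`) and not frozen open
(a frozen open edge with an endpoint in `V` is a spoke at an arc vertex, `se_openEdges_arc`). [folklore] -/
theorem ei_exteriorEdge_not_mem_cfgOf (hω : ω ⊆ M.E) {v : ℤ × ℤ} {K : Fin 4} (hv : v ∈ M.V)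
    (htip : v + dir K ∉ M.V) (harc : v ∉ M.arcVerts) :
    s(toSite v, toSite v + cornerUnit K) ∉ M.cfgOf ω := by
  have hK : K + 3 + 1 = K := by fin_cases K <;> rfl
  have hct : cTgt (toSite v, K + 3) = s(toSite v, toSite v + cornerUnit K) := by rw [cTgt, hK]
  rw [← hct]
  obtain ⟨e, hc, hend⟩ := se_corner_edge v (K + 3)
  rw [hK] at hend
  intro hmem
  rcases (se_cTgt_mem_cfgOf_iff M ω hc).1 hmem with he | he
  · -- live: both endpoints in `V`
    have hE := hω he
    rw [E, inducedEdges, mem_filter] at hE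
    rcases hend with ⟨-, h2⟩ | ⟨h1, -⟩
    · exact htip (h2 ▸ hE.2.2)
    · exact htip (h1 ▸ hE.2.1)
  · -- frozen open: a spoke at an arc vertex
    have hVend : e.1 ∈ M.V ∨ SixVertex.edgeTip e ∈ M.V := by
      rcases hend with ⟨h1, -⟩ | ⟨-, h2⟩
      · exact Or.inl (h1 ▸ hv)
      · exact Or.inr (h2 ▸ hv)
    have harcV : M.arcVerts ⊆ M.V := Finset.inter_subset_right
    rcases se_openEdges_arc M he hVend with ha | ha
    · rcases hend with ⟨h1, -⟩ | ⟨h1, -⟩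
      · exact harc (h1 ▸ ha)
      · exact htip (h1 ▸ harcV ha)
    · rcases hend with ⟨-, h2⟩ | ⟨-, h2⟩
      · exact htip (h2 ▸ harcV ha)
      · exact harc (h2 ▸ ha)

/-- **The collar faces of a free stretch form a closed-edge face chain.** Along the walk
`e i = (dsucc V)^[i] d₀` of exterior darts of `M.V`, if every dart `e i` with `a < i ≤ b` sits at a
vertex that is not an arc vertex, then the gap faces of `e a` and `e b`, read as faces of the corner
calculus, are joined by a chain of faces consecutive ones of which are the two faces of a lattice edge
absent from `M.cfgOf ω` (the exterior edge of the later dart). [folklore] -/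
theorem ei_faceChain_of_free {M : CollarLegModel} {ω : Finset ((ℤ × ℤ) × Bool)} (hω : ω ⊆ M.E)
    {d₀ : Dart} (hd₀ : d₀.1 ∈ M.V) (hd₀' : dartTip d₀ ∉ M.V) {a b : ℕ} (hab : a ≤ b)
    (hfree : ∀ i, a < i → i ≤ b → ((dsucc M.V)^[i] d₀).1 ∉ M.arcVerts) :
    Relation.ReflTransGen (fun f g : Site 2 => ∃ (x : Site 2) (k : Fin 4), s(x, x + cornerUnit k) ∉ M.cfgOf ω ∧
        ((f = faceAt x (k + 3) ∧ g = faceAt x k) ∨ (f = faceAt x k ∧ g = faceAt x (k + 3))))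
      (faceAt (toSite ((dsucc M.V)^[a] d₀).1) ((dsucc M.V)^[a] d₀).2)
      (faceAt (toSite ((dsucc M.V)^[b] d₀).1) ((dsucc M.V)^[b] d₀).2) := by
  induction b, hab using Nat.le_induction with
  | base => exact Relation.ReflTransGen.refl
  | succ b hab ih =>
    refine (ih fun i hi hib => hfree i hi (Nat.le_succ_of_le hib)).tail ?_
    -- the step from `e b` to `e (b+1) = (v, K)`
    set d := (dsucc M.V)^[b] d₀ with hd
    have hsucc : (dsucc M.V)^[b + 1] d₀ = dsucc M.V d := by
      rw [Function.iterate_succ_apply', ← hd]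
    obtain ⟨⟨v, K⟩, hdef⟩ : ∃ q : Dart, dsucc M.V d = q := ⟨_, rfl⟩
    rw [hsucc, hdef]
    -- exterior-ness of the darts
    have hext : ∀ i, ((dsucc M.V)^[i] d₀).1 ∈ M.V ∧ dartTip ((dsucc M.V)^[i] d₀) ∉ M.V :=
      fun i => (s3_dsucc_iterate M.V i).1 d₀ hd₀ hd₀'
    have hv : v ∈ M.V := by
      have := (hext (b + 1)).1; rwa [hsucc, hdef] at this
    have htip : v + dir K ∉ M.V := by
      have := (hext (b + 1)).2; rwa [hsucc, hdef, dartTip] at this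
    have harc : v ∉ M.arcVerts := by
      have := hfree (b + 1) (Nat.lt_succ_of_le hab) le_rfl; rwa [hsucc, hdef] at this
    -- the two gap faces are the two faces of the exterior edge at `v`
    have hfa : faceAt (toSite d.1) d.2 = faceAt (toSite v) (K + 3) := by
      apply ei_ofSite_injective
      rw [← ei_gapFace_dsucc_site hdef, ← ei_gapFace_site]
    refine ⟨toSite v, K, ei_exteriorEdge_not_mem_cfgOf hω hv htip harc, Or.inl ⟨hfa, rfl⟩⟩

end FreeStretch

end Summit.CriticalPhenomena.CardyFormulaZ2.Cruxes.RectilinearCardy.ExcursionKernelCovariance
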